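import Mathlib
import Literature.Analysis.FluidPDE.CompressibleEulerImplosionShootingN
import Summits.AtomisticToContinuum.HydrodynamicLimit.Theorems.ImplosionDichotomyDenseExcursionSonicPinnedProfile

/-!
# The pinned BCG profile on the NARROWED shooting window `[r_d, 13923249/12500000]` (crux `DenseExcursion`,
# line `sonic-cavity-renewal`, brick `exists_pinnedProfile_narrowN`)

Helper file (`--supports stmt-AtomisticToContinuum-12586`) for the registered stub `stub_boxPackage` of the line
`sonic-cavity-renewal` (crux `Summit.AtomisticToContinuum.HydrodynamicLimit.Theses.ImplosionDichotomy.DenseExcursion`).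
Re-run of `…SonicPinnedGlue.lean` / `…SonicPinnedProfile.lean` (`exists_meetingWZ`, `exists_sonicWZ`,
`exists_pinnedProfile`) with the shooting done on the narrower window `[r_d, 13923249/12500000] = [1.107648, 1.11385992]`
(`Literature…CompressibleEulerImplosionShootingN.exists_meetingN`, whose right end is the new kernel-certified right
barrier `Literature…CompressibleEulerImplosionRightN` at `r = 13923249/12500000`, `p(r) = 1193/2500`). Since `13923249/12500000 ≤ 279/250`,
the exact repulsivity `κ(r) = 2 − r − √(2(r−1))` of the pinned profile (the `deriv` clause) is `≥ 2/5`
(`kappa_ge_two_fifths`): clause (a).5 of `CavityTube` for the witness of `stub_boxPackage`, in addition to (a).1–3.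

* `exists_meetingWZ_narrowN`, `exists_sonicWZ_narrowN` — verbatim re-instantiations;
* `exists_pinnedProfile_narrowN` (registered) — as `exists_pinnedProfile` with the window `[17307/15625, 13923249/12500000]` and the
  extra conjunct `deriv W 0 + deriv S 0 ≤ −2/5`.

Sources: Buckmaster–Cao-Labora–Gómez-Serrano 2025, Thm 1.1, §2.1 (P_s, (2.6)), Props. 2.2–2.3, Prop. 4.1, §6.
-/

noncomputable section

open Set Filter Metric Topology
open scoped ContDiff

namespace Summit.AtomisticToContinuum.HydrodynamicLimit.Theorems.SonicCavityRenewal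

open Literature.MathematicalPhysics.KineticTheory (V3)
open Literature.Analysis.FluidPDE.BuckmasterCaolaboraGomezserrano2025
open Literature.Analysis.FluidPDE.BuckmasterCaolaboraGomezserrano2025.Monatomic
open Literature.Analysis.FluidPDE.BuckmasterCaolaboraGomezserrano2025.Monatomic.SonicSeries
open Summit.AtomisticToContinuum.HydrodynamicLimit.Theorems.R2OneModeTwoConditions
open Summit.AtomisticToContinuum.HydrodynamicLimit.Theorems.KidderKnobMelnikov
  (differentiableAt_of_radialScalar differentiableAt_of_radialField)

/-- **The pinned orbit exists on the shooting window.** For some `r` in the kernel-certified shooting window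
`[r_d, 13923249/12500000] = [17307/15625, 13923249/12500000]` (`ShootingN.exists_meetingN`: the `P₀` trajectory meets the branch through
`P_s`; `Monatomic.leftData_all`: the 32 certified Taylor-model windows continue the branch to `P_∞`) there is a global
`C^∞` solution `(W, Z)` of the autonomous system (1.8) of Buckmaster–Cao-Labora–Gómez-Serrano (`γ = 5/3`) with
`Z < W`, `(W, Z) → P_∞ = (0, 0)`, issuing from `P₀` with the explicit analytic origin germ `OriginSeries.profile r 1`
(`A = 1`), which near some `T₀` is the analytic branch through the sonic point `P_s` (shifted to `T₀`) and has
`D_Z < 0` for `ξ < T₀`, `D_Z > 0` for `ξ > T₀`. [cite: BuckmasterCaolaboraGomezserrano2025, Thm 1.1, §6, Prop. 3.1] -/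
theorem exists_meetingWZ_narrowN : ∃ r : ℝ, ((17307 / 15625 : ℝ) ≤ r ∧ r ≤ 13923249 / 12500000) ∧ ∃ (W Z : ℝ → ℝ) (T₀ : ℝ), ContDiff ℝ ∞ W ∧ ContDiff ℝ ∞ Z ∧ (∀ ξ, DW (W ξ) (Z ξ) * deriv W ξ = NW r (W ξ) (Z ξ) ∧ DZ (W ξ) (Z ξ) * deriv Z ξ = NZ r (W ξ) (Z ξ)) ∧ (∀ ξ, Z ξ < W ξ) ∧ Tendsto W atTop (𝓝 0) ∧ Tendsto Z atTop (𝓝 0) ∧ (∃ ε : ℝ, 0 < ε ∧ ∀ ζ ∈ Set.Ioo 0 ε, ζ * W (Real.log ζ) = OriginSeries.profile r 1 ζ ∧ -ζ * Z (Real.log ζ) = OriginSeries.profile r 1 (-ζ)) ∧ (W =ᶠ[𝓝 T₀] fun x => Wloc r (x - T₀)) ∧ (Z =ᶠ[𝓝 T₀] fun x => Zloc r (x - T₀)) ∧ (∀ ξ, ξ < T₀ → DZ (W ξ) (Z ξ) < 0) ∧ (∀ ξ, T₀ < ξ → 0 < DZ (W ξ) (Z ξ)) := by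
  obtain ⟨r, hr, hmeet⟩ := ShootingN.exists_meetingN
  obtain ⟨h1, h2, h3, h4, _⟩ := ShootingN.windowN hr
  obtain ⟨_, hgerm, hode, hΩ, _, _, _⟩ := Shooting.traj_spec h1 h2
  obtain ⟨haθ, hθb, _⟩ := ShootingN.θN_spec hr
  obtain ⟨hs, hall, _⟩ := ShootingN.sN_spec
  obtain ⟨hsρ, hsonic⟩ := hall r hr
  obtain ⟨Wl, Zl, δ, hδ, hbranch, hl, hloff, hlimW, hlimZ⟩ := Monatomic.leftData_all r (ShootingN.mem_window_of hr)
  obtain ⟨W, Z, hW, hZ, heq, hWZ, hlW, hlZ, horigin, hbW, hbZ, hneg, hpos⟩ :=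
    globalWZ_of_meeting h3 h4 (𝒲 := OriginSeries.profile r 1) haθ hθb
      (fun ξ hξ => by rw [hgerm ξ hξ]; rfl) hode hΩ hs hsρ hmeet
      (fun t ht => ⟨(hsonic t ht.1 ht.2).1, (hsonic t ht.1 ht.2).2.1, (hsonic t ht.1 ht.2).2.2.1⟩)
      hδ hbranch hl hloff hlimW hlimZ
  have hr' : (17307 / 15625 : ℝ) ≤ r ∧ r ≤ 13923249 / 12500000 := by
    rw [Shooting.rd_eq, ShootingN.rhi_eq] at hr; exact hr
  exact ⟨r, hr', W, Z, ShootingN.θN r - ShootingN.sN, hW, hZ, heq, hWZ, hlW, hlZ,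
    ⟨Real.exp (Germ.ξA - 1), Real.exp_pos _, horigin⟩, hbW, hbZ, hneg, hpos⟩

/-- **The pinned orbit with its sonic point at `ξ = 0`.** Translate the orbit of `exists_meetingWZ_narrowN` by `T₀`: for some
`r ∈ [17307/15625, 13923249/12500000]` a global `C^∞` solution `(W, Z)` of (1.8) with `Z < W`, `(W, Z) → (0, 0)`, an analytic
positive origin germ, which near `0` IS the analytic branch `(W^{(r)}, Z^{(r)})` through `P_s`, with `D_Z < 0` on `ξ < 0` and
`D_Z > 0` on `ξ > 0`. [cite: BuckmasterCaolaboraGomezserrano2025, Thm 1.1, §6, Props. 2.2–2.3] -/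
theorem exists_sonicWZ_narrowN : ∃ r : ℝ, ((17307 / 15625 : ℝ) ≤ r ∧ r ≤ 13923249 / 12500000) ∧ ∃ (W Z : ℝ → ℝ),
    ContDiff ℝ ∞ W ∧ ContDiff ℝ ∞ Z ∧
    (∀ ξ, DW (W ξ) (Z ξ) * deriv W ξ = NW r (W ξ) (Z ξ) ∧ DZ (W ξ) (Z ξ) * deriv Z ξ = NZ r (W ξ) (Z ξ)) ∧
    (∀ ξ, Z ξ < W ξ) ∧ Tendsto W atTop (𝓝 0) ∧ Tendsto Z atTop (𝓝 0) ∧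
    (∃ g : ℝ → ℝ, AnalyticAt ℝ g 0 ∧ 0 < g 0 ∧ ∃ ε : ℝ, 0 < ε ∧
      ∀ ζ ∈ Ioo 0 ε, ζ * W (Real.log ζ) = g ζ ∧ -ζ * Z (Real.log ζ) = g (-ζ)) ∧
    W =ᶠ[𝓝 0] Wloc r ∧ Z =ᶠ[𝓝 0] Zloc r ∧
    (∀ ξ, ξ < 0 → DZ (W ξ) (Z ξ) < 0) ∧ (∀ ξ, 0 < ξ → 0 < DZ (W ξ) (Z ξ)) := by
  obtain ⟨r, hr, W, Z, T₀, hW, hZ, heq, hWZ, hlW, hlZ, ⟨ε, hε, horigin⟩, hbW, hbZ, hneg, hpos⟩ :=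
    exists_meetingWZ_narrowN
  have hprof := originProfile_analytic (r := r) one_pos
  set c : ℝ := Real.exp T₀ with hc
  have hc0 : 0 < c := Real.exp_pos _
  have hshift : Tendsto (fun x : ℝ => x + T₀) (𝓝 0) (𝓝 T₀) := by
    have h := (tendsto_id (x := 𝓝 (0 : ℝ))).add_const T₀
    simpa using h
  refine ⟨r, hr, fun x => W (x + T₀), fun x => Z (x + T₀), hW.comp (contDiff_id.add contDiff_const),
    hZ.comp (contDiff_id.add contDiff_const), fun ξ => ?_, fun ξ => hWZ _,
    hlW.comp (tendsto_atTop_add_const_right _ T₀ tendsto_id),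
    hlZ.comp (tendsto_atTop_add_const_right _ T₀ tendsto_id),
    ⟨fun ζ => c⁻¹ * OriginSeries.profile r 1 (c * ζ), ?_, ?_, c⁻¹ * ε, by positivity, fun ζ hζ => ?_⟩,
    ?_, ?_, fun ξ hξ => hneg _ (by linarith), fun ξ hξ => hpos _ (by linarith)⟩
  · -- the equations (autonomous system)
    rw [deriv_comp_add_const, deriv_comp_add_const]; exact heq _
  · -- the rescaled origin germ is analytic at `0`
    refine analyticAt_const.mul (hprof.1.comp_of_eq ?_ (by simp))
    exact analyticAt_const.mul analyticAt_id
  · -- and positive there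
    simp only [mul_zero, hprof.2]; positivity
  · -- the origin germ after translation
    obtain ⟨hζ0, hζε⟩ := hζ
    have hcζ : c * ζ ∈ Ioo 0 ε := ⟨by positivity, by rwa [lt_inv_mul_iff₀ hc0] at hζε⟩
    obtain ⟨h1, h2⟩ := horigin (c * ζ) hcζ
    have hlog : Real.log ζ + T₀ = Real.log (c * ζ) := by
      rw [Real.log_mul hc0.ne' hζ0.ne', hc, Real.log_exp]; ring
    beta_reduce
    rw [hlog, show c * -ζ = -(c * ζ) by ring, ← h1, ← h2]
    constructor <;> field_simp
  · -- near `0`, `W(· + T₀)` is the branch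
    have h := hbW.comp_tendsto hshift
    refine h.trans (Eventually.of_forall fun x => ?_)
    simp
  · have h := hbZ.comp_tendsto hshift
    refine h.trans (Eventually.of_forall fun x => ?_)
    simp

/-- NARROW-WINDOW VERSION (right barrier `RightN` at `13923249/12500000 = 1.11385992`, where `κ ≥ 0.4088`): **Brick `exists_pinnedProfile` of stub `stub_boxPackage` (line `sonic-cavity-renewal`): THE PINNED PROFILE WITH ITS SONIC
NORMALISATION.** There are a speed `r` in the kernel-certified shooting window `[17307/15625, 89409/80000] ∋ r₂` and a profile
`(W, S)` (the change of variables `W = wOf U = −(W_c + Z_c)/2`, `S = sOf S_c = (W_c − Z_c)/6` of the BCG orbit of `exists_sonicWZ`)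
with: `IsMonatomicProfile r W S`; the momentum and mass equations in original form (`OrigProfileEqs`); the sonic point AT `x = 0`:
`W 0 + S 0 = 1` (`W + S = 1 − D_Z`), `W + S > 1` for `x < 0` and `W + S < 1` for `x > 0` (the first three clauses of `CavityTube` (a));
the exact repulsivity `W′(0) + S′(0) = −(2 − r − √(2(r−1)))` (`= −κ(r)`, from the branch slopes `(W₁, Z₁)` at `P_s`); the exact
sonic value `W(0) = (r − √(r² − 6r + 6))/2`; and real-analyticity of `W`, `S` at the sonic point (the analytic branch of BCG
Props. 2.2–2.3). [cite: BuckmasterCaolaboraGomezserrano2025, Thm 1.1, §2.1, Props. 2.2–2.3, §6] -/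
theorem exists_pinnedProfile_narrowN : ∃ (r : ℝ) (W S : ℝ → ℝ), ((17307 / 15625 : ℝ) ≤ r ∧ r ≤ 13923249 / 12500000) ∧ IsMonatomicProfile r W S ∧ OrigProfileEqs r W S ∧ W 0 + S 0 = 1 ∧ (∀ x, x < 0 → 1 < W x + S x) ∧ (∀ x, 0 < x → W x + S x < 1) ∧ deriv W 0 + deriv S 0 = -(2 - r - Real.sqrt (2 * (r - 1))) ∧ deriv W 0 + deriv S 0 ≤ -(2 / 5) ∧ W 0 = (r - Real.sqrt (r ^ 2 - 6 * r + 6)) / 2 ∧ AnalyticAt ℝ W 0 ∧ AnalyticAt ℝ S 0 := by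
  obtain ⟨r, hr, Wc, Zc, hW, hZ, heq, hWZ, hlW, hlZ, ⟨g, hg, hg0, ε, hε, horigin⟩, hbW, hbZ, hneg, hpos⟩ :=
    exists_sonicWZ_narrowN
  have hr₃ : 1.10102 < r := by norm_num at hr ⊢; linarith [hr.1]
  have hr₄ : r < 1.13476 := by norm_num at hr ⊢; linarith [hr.2]
  have hrκ : r ≤ 279 / 250 := by norm_num at hr ⊢; linarith [hr.2]
  have h3 : r3 < r := lt_of_lt_of_le (by have := Shooting.r3_lt_rd; rwa [Shooting.rd_eq] at this) hr.1
  have h4 : r < r4 := lt_of_le_of_lt hr.2 (by have := ShootingN.rhi_lt_r4; rwa [ShootingN.rhi_eq] at this)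
  obtain ⟨U, S, hU3, hS3, hode, hSpos, hUinf, hSinf, hdict⟩ :=
    profileData_of_WZ hW hZ heq hWZ hlW hlZ hg hg0 hε horigin
  -- the dictionary as function identities
  have hWf : wOf U = fun x => -(Wc x + Zc x) / 2 := funext fun x => (hdict x).1
  have hSf : sOf S = fun x => (Wc x - Zc x) / 6 := funext fun x => (hdict x).2
  have hsum : ∀ x, wOf U x + sOf S x = 1 - DZ (Wc x) (Zc x) := fun x => by
    rw [(hdict x).1, (hdict x).2]; unfold DZ; ring
  -- the branch data at the sonic point
  obtain ⟨hW0, hZ0, hW1, hZ1, hspec⟩ := sonicSeries_spec' h3 h4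
  have hρ : |(0 : ℝ)| < sonicRad r := by rw [abs_zero]; exact sonicRad_pos (h4.trans r3_r4_mem.2.2)
  obtain ⟨hanW, hanZ, -, -⟩ := hspec 0 hρ
  have hWc0 : Wc 0 = W0 r := by rw [hbW.eq_of_nhds, hW0]
  have hZc0 : Zc 0 = Z0 r := by rw [hbZ.eq_of_nhds, hZ0]
  have hdWc : deriv Wc 0 = W1 r := by rw [hbW.deriv_eq, hW1]
  have hdZc : deriv Zc 0 = Z1 r := by rw [hbZ.deriv_eq, hZ1]
  have hWd : Differentiable ℝ Wc := hW.differentiable (by simp)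
  have hZd : Differentiable ℝ Zc := hZ.differentiable (by simp)
  have hdisc : 0 ≤ disc r := (disc_pos (h4.trans r3_r4_mem.2.2)).le
  have hκ' : deriv (wOf U) 0 + deriv (sOf S) 0 = -(2 - r - Real.sqrt (2 * (r - 1))) := by
    have hdW : deriv (wOf U) 0 = -(deriv Wc 0 + deriv Zc 0) / 2 := by
      rw [hWf]
      exact (((hWd 0).hasDerivAt.add (hZd 0).hasDerivAt).neg.div_const 2).deriv
    have hdS : deriv (sOf S) 0 = (deriv Wc 0 - deriv Zc 0) / 6 := by
      rw [hSf]
      exact (((hWd 0).hasDerivAt.sub (hZd 0).hasDerivAt).div_const 6).deriv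
    rw [hdW, hdS, hdWc, hdZc]
    unfold W1 Z1 Monatomic.p
    ring
  refine ⟨r, wOf U, sOf S, hr, isMonatomicProfile_wOf_sOf hr₃ hr₄ hU3 hS3 hode hSpos hUinf hSinf, fun x => ?_, ?_,
    fun x hx => ?_, fun x hx => ?_, hκ', ?_, ?_, ?_, ?_⟩
  · -- the equations in original form
    have hζ : 0 < Real.exp x := Real.exp_pos x
    obtain ⟨h1, h2⟩ := hode (Real.exp x) hζ
    exact origProfileEqs_of_bcg (differentiableAt_of_radialField hU3 hζ) (differentiableAt_of_radialScalar hS3 hζ) h1 h2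
  · -- `W 0 + S 0 = 1`
    rw [hsum, hWc0, hZc0, DZ_Ps]; ring
  · -- `x < 0`: `D_Z < 0`
    rw [hsum]; linarith [hneg x hx]
  · -- `x > 0`: `D_Z > 0`
    rw [hsum]; linarith [hpos x hx]
  · -- `κ(r) ≥ 2/5` on the narrowed window (`r ≤ 13923249/12500000 ≤ 279/250`)
    rw [hκ']
    linarith [kappa_ge_two_fifths hrκ]
  · -- the sonic value `W(0) = (r - q)/2`
    rw [(hdict 0).1, hWc0, hZc0]
    unfold W0 Z0 Monatomic.q disc
    ring
  · -- analyticity at the sonic point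
    rw [hWf]
    exact ((hanW.congr hbW.symm).add (hanZ.congr hbZ.symm)).neg.div_const
  · rw [hSf]
    exact ((hanW.congr hbW.symm).sub (hanZ.congr hbZ.symm)).div_const

end Summit.AtomisticToContinuum.HydrodynamicLimit.Theorems.SonicCavityRenewal

end
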